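import Summits.AtomisticToContinuum.Crystallization.Theorems.ChartedPlanarOrderStraddleSummable

/-!
# OverbindingBudget · decomp-a2c lens-4 g34 — part XXII-V: the two analytic seams of GEO-OSC (zero gap stress ⇒ narrow height band)

Helper file under `--supports stmt-AtomisticToContinuum-31280` (RDEF = `Theses.OverbindingBudget.RobustDefectLimitWindows`); closes nothing.

Cone XXXVII (part U) leaves on the energy side, besides the finite window tables, the per-configuration height band GEO-OSC
`…EnergyAffineStraightening.StackedHeightsOsc Λ₁ ω`: for a separated, clean, Nash, stress-free stacked configuration with ZERO TRANSMITTED GAP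
STRESS, all gap heights lie in one band of width `≤ ω`.  The planned g35 decomposition (memo §I) is a diagonal-dominance (contraction) argument
on the normal force balance of each gap: zero gap stress says the ADJACENT layer force across gap `m` equals minus the sum of the forces of
all other layer pairs straddling `m` (this file, §1, PROVED: `layerForce_adj_eq_neg_farStress`); the adjacent normal force is strictly monotone
in the gap height with slope `≥ G` near the hollow registry while the far sum is Lipschitz in the other heights with constants summing to `C < G`
and varies by `≤ r` with the far registries (census certificate, per cell box); the abstract sup-norm contraction lemma (§2, PROVED:
`abs_le_of_sup_contraction`) then confines every height to within `r/(G − C)` of the cell's reference height `h⋆(a, b)` — the same for both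
hollow registries of any cell, by the centrosymmetry of the layer lattice (`…EnergySiteDecomposition.layerField_neg`).

Contents: §1 `farStress` (the straddling sum with the adjacent pair `(m−1, m)` removed) and the splitting identities
`gapStress_incr_eq_adj_add_far`, `layerForce_adj_eq_neg_farStress`, `inner_layerForce_adj_eq` (summability from lens-3's
`summable_pairFamily_straddle`: independence + stacking + separation only, NO cleanliness); §2 `abs_le_of_sup_contraction`,
`abs_sub_le_of_sup_contraction` (pure real analysis over `ℤ`-indexed profiles).
-/

namespace Summit.AtomisticToContinuum.Crystallization.Theorems.OverbindingBudgetEnergyHeightsSeam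

open scoped RealInnerProductSpace
open Summit.AtomisticToContinuum.Crystallization.Theorems.ChartedPlanarOrderChunkFloor (E3)
open Summit.AtomisticToContinuum.Crystallization.Theorems.ChartedPlanarOrderDensityDichotomy (IsSep)
open Summit.AtomisticToContinuum.Crystallization.Theorems.ChartedPlanarOrderDoorLayered (Layered)
open Summit.AtomisticToContinuum.Crystallization.Theorems.ChartedPlanarOrderProfileSlavingLJ (layerForce IsStacked gapStress incr)
open Summit.AtomisticToContinuum.Crystallization.Theorems.ChartedPlanarOrderProfileSlavingLJBalance (pairFamily straddleSet gapStress_incr_eq)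
open Summit.AtomisticToContinuum.Crystallization.Theorems.ChartedPlanarOrderStraddleSummable (summable_pairFamily_straddle)

/-! ## §1 Splitting the adjacent pair off the straddling sum -/

variable {a b : E3} {w : ℤ → E3} {δ : ℝ}

/-- the adjacent pair `(m − 1, m)` straddles gap `m`. -/
theorem adj_mem_straddleSet (m : ℤ) : (m - 1, m) ∈ straddleSet m := by
  simp only [straddleSet, Set.mem_setOf_eq]; omega

/-- the adjacent pair as an element of the straddle set. -/
def adjPair (m : ℤ) : straddleSet m := ⟨(m - 1, m), adj_mem_straddleSet m⟩

/-- **far stress across gap `m`**: the straddling layer-pair force sum with the adjacent pair `(m − 1, m)` removed (junk `0` if divergent). -/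
noncomputable def farStress (a b : E3) (w : ℤ → E3) (m : ℤ) : E3 :=
  ∑' p : straddleSet m, if p = adjPair m then 0 else layerForce a b (w (p : ℤ × ℤ).1 - w (p : ℤ × ℤ).2)

/-- the adjacent term of the pair family is the adjacent layer force `layerForce a b (w (m−1) − w m)`. -/
theorem pairFamily_adjPair (a b : E3) (w : ℤ → E3) (m : ℤ) :
    pairFamily a b w (adjPair m : straddleSet m) = layerForce a b (w (m - 1) - w m) := rfl

/-- **splitting identity**: the transmitted gap stress is the adjacent layer force plus the far stress (independent, stacked, separated
configurations — lens-3's straddle summability; no cleanliness needed). -/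
theorem gapStress_incr_eq_adj_add_far (hδ : 0 < δ) (hab : LinearIndependent ℝ ![a, b]) (hst : IsStacked a b w)
    (hS : IsSep δ (Layered a b w)) (m : ℤ) :
    gapStress a b m (incr w) = layerForce a b (w (m - 1) - w m) + farStress a b w m := by
  have hSm := summable_pairFamily_straddle hδ hab hst hS m
  rw [gapStress_incr_eq]
  have e : ∑' p : straddleSet m, pairFamily a b w p = ∑' p : straddleSet m, (pairFamily a b w ∘ (↑)) p := rfl
  rw [e, hSm.tsum_eq_add_tsum_ite (adjPair m)]
  rfl

/-- **ZERO GAP STRESS ⇒ the adjacent layer force is minus the far stress.** -/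
theorem layerForce_adj_eq_neg_farStress (hδ : 0 < δ) (hab : LinearIndependent ℝ ![a, b]) (hst : IsStacked a b w)
    (hS : IsSep δ (Layered a b w)) {m : ℤ} (h0 : gapStress a b m (incr w) = 0) :
    layerForce a b (w (m - 1) - w m) = -farStress a b w m := by
  rw [gapStress_incr_eq_adj_add_far hδ hab hst hS m] at h0
  exact eq_neg_of_add_eq_zero_left h0

/-- the same with the adjacent offset written as `−incr w m`. -/
theorem layerForce_neg_incr_eq (hδ : 0 < δ) (hab : LinearIndependent ℝ ![a, b]) (hst : IsStacked a b w)
    (hS : IsSep δ (Layered a b w)) {m : ℤ} (h0 : gapStress a b m (incr w) = 0) :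
    layerForce a b (-incr w m) = -farStress a b w m := by
  rw [show -incr w m = w (m - 1) - w m from by simp only [incr, neg_sub]]
  exact layerForce_adj_eq_neg_farStress hδ hab hst hS h0

/-- normal component: zero gap stress ⇒ `⟪adjacent layer force, n⟫ = −⟪far stress, n⟫`, hence `|⟪adjacent, n⟫| = |⟪far, n⟫|`. -/
theorem inner_layerForce_adj_eq (hδ : 0 < δ) (hab : LinearIndependent ℝ ![a, b]) (hst : IsStacked a b w)
    (hS : IsSep δ (Layered a b w)) {m : ℤ} (h0 : gapStress a b m (incr w) = 0) (n : E3) :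
    ⟪layerForce a b (w (m - 1) - w m), n⟫ = -⟪farStress a b w m, n⟫ ∧
      |⟪layerForce a b (w (m - 1) - w m), n⟫| = |⟪farStress a b w m, n⟫| := by
  rw [layerForce_adj_eq_neg_farStress hδ hab hst hS h0, inner_neg_left]
  exact ⟨rfl, abs_neg _⟩

/-! ## §2 The sup-norm contraction lemma -/

/-- **diagonal dominance in sup norm**: if a bounded profile `d : ℤ → ℝ` satisfies `G·|d m| ≤ C·sup |d| + r` at every `m` with `C < G`,
then `|d m| ≤ r/(G − C)` everywhere.  (In the g35 node: `d m = h_m − h⋆(a,b)`, `G` = adjacent normal stiffness floor, `C` = sum of the far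
pairs' height-Lipschitz constants, `r` = registry variation of the far stress.) -/
theorem abs_le_of_sup_contraction {d : ℤ → ℝ} {G C r : ℝ} (hCG : C < G) (hC : 0 ≤ C)
    (hbdd : BddAbove (Set.range fun m => |d m|)) (h : ∀ m, G * |d m| ≤ C * (⨆ m', |d m'|) + r) (m : ℤ) :
    |d m| ≤ r / (G - C) := by
  set S := ⨆ m', |d m'| with hSdef
  have hle : ∀ k, |d k| ≤ S := fun k => le_ciSup hbdd k
  have hS0 : 0 ≤ S := (abs_nonneg _).trans (hle 0)
  have hG : 0 < G := lt_of_le_of_lt hC hCG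
  have hSup : S ≤ (C * S + r) / G := by
    refine ciSup_le fun k => ?_
    rw [le_div_iff₀ hG]
    linarith [h k]
  have h1 : G * S ≤ C * S + r := by rwa [le_div_iff₀ hG, mul_comm] at hSup
  have h2 : S ≤ r / (G - C) := by
    rw [le_div_iff₀ (sub_pos.mpr hCG)]
    linarith
  exact (hle m).trans h2

/-- the same about a reference value: `G·|h m − c| ≤ C·sup_m' |h m' − c| + r` everywhere and `C < G` confine `h` to the band
`[c − r/(G − C), c + r/(G − C)]` (of width `2r/(G − C)`). -/
theorem abs_sub_le_of_sup_contraction {h : ℤ → ℝ} {c G C r : ℝ} (hCG : C < G) (hC : 0 ≤ C)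
    (hbdd : BddAbove (Set.range fun m => |h m - c|)) (hh : ∀ m, G * |h m - c| ≤ C * (⨆ m', |h m' - c|) + r) (m : ℤ) :
    c - r / (G - C) ≤ h m ∧ h m ≤ c + r / (G - C) := by
  have key := abs_le_of_sup_contraction (d := fun m => h m - c) hCG hC hbdd hh m
  rw [abs_le] at key
  constructor <;> linarith [key.1, key.2]

/-- boundedness of the deviation profile from an a-priori band (as supplied by `…EnergyStraighteningHeights.stackedHeights_holds`:
all heights in `[3/8, 23/20]`). -/
theorem bddAbove_abs_sub_of_mem_Icc {h : ℤ → ℝ} {η₁ η₂ c : ℝ} (hh : ∀ m, η₁ ≤ h m ∧ h m ≤ η₂) :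
    BddAbove (Set.range fun m => |h m - c|) := by
  refine ⟨max (η₂ - c) (c - η₁), ?_⟩
  rintro _ ⟨m, rfl⟩
  rw [abs_le]
  obtain ⟨h1, h2⟩ := hh m
  constructor
  · have := le_max_right (η₂ - c) (c - η₁); linarith
  · have := le_max_left (η₂ - c) (c - η₁); linarith

end Summit.AtomisticToContinuum.Crystallization.Theorems.OverbindingBudgetEnergyHeightsSeam
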